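import Summits.Ventures.PercRepro.ConnJoin
import Summits.Ventures.PercRepro.ReachFromRel

/-!
# Within-part connectivity is decidable on finite types

`ConnIn S pe i` is the reflexive–transitive closure of the symmetric decidable relation
`OpenAdjIn S pe i`, hence reachability in `SimpleGraph.fromRel` (`connIn_iff_reachable`) and decidable
when `V` and `E` are finite; the same for the join step between terminals and its closure
(`chain_iff_reachable`).  So the per-part data of a concrete gadget — which terminals a branch
connects, in which configurations — are settled by `decide`.
-/

namespace PercRepro

namespace MultiGraph

variable {V E ι : Type*} {G : MultiGraph V E}

/-- A part step is decidable on finite edge types. -/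
instance decidableOpenAdjIn [Fintype E] [DecidableEq V] [DecidableEq ι] (S : Config E) (pe : E → ι)
    (i : ι) (x y : V) : Decidable (G.OpenAdjIn S pe i x y) := by
  unfold OpenAdjIn
  infer_instance

/-- Within-part connectivity is reachability in the graph of the part's open edges. -/
theorem connIn_iff_reachable (S : Config E) (pe : E → ι) (i : ι) (u v : V) :
    G.ConnIn S pe i u v ↔ (SimpleGraph.fromRel (G.OpenAdjIn S pe i)).Reachable u v :=
  reflTransGen_iff_reachable_fromRel (fun _ _ h => h.symm) u v

/-- Within-part connectivity is decidable on finite types. -/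
instance decidableConnIn [Fintype V] [DecidableEq V] [Fintype E] [DecidableEq ι] (S : Config E)
    (pe : E → ι) (i : ι) (u v : V) : Decidable (G.ConnIn S pe i u v) :=
  decidable_of_iff _ (G.connIn_iff_reachable S pe i u v).symm

/-- A join step is decidable on finite types. -/
instance decidableJoinStep [Fintype V] [DecidableEq V] [Fintype E] [Fintype ι] [DecidableEq ι]
    (S : Config E) (Cen : Set V) [DecidablePred (· ∈ Cen)] (pe : E → ι) (t t' : V) :
    Decidable (G.JoinStep S Cen pe t t') := by
  unfold JoinStep
  infer_instance

/-- The chain of join steps is reachability in the graph of join steps. -/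
theorem chain_iff_reachable (S : Config E) (Cen : Set V) (pe : E → ι) (u v : V) :
    Relation.ReflTransGen (G.JoinStep S Cen pe) u v ↔
      (SimpleGraph.fromRel (G.JoinStep S Cen pe)).Reachable u v :=
  reflTransGen_iff_reachable_fromRel (fun _ _ h => h.symm) u v

/-- The chain of join steps is decidable on finite types. -/
instance decidableChain [Fintype V] [DecidableEq V] [Fintype E] [Fintype ι] [DecidableEq ι]
    (S : Config E) (Cen : Set V) [DecidablePred (· ∈ Cen)] (pe : E → ι) (u v : V) :
    Decidable (Relation.ReflTransGen (G.JoinStep S Cen pe) u v) :=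
  decidable_of_iff _ (G.chain_iff_reachable S Cen pe u v).symm

end MultiGraph

end PercRepro
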